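import Literature.MathematicalPhysics.QuantumLattice.FermionicTreeExpansion
import Literature.MathematicalPhysics.QuantumLattice.GrassmannTruncatedExpectation
import Literature.MathematicalPhysics.QuantumLattice.GrassmannGaussianMoments
import HarnessLib

/-!
# The tree expansion of the truncated expectations of a Gaussian Grassmann integration
(Benfatto–Giuliani–Mastropietro 2006, (2.66), for balanced even monomials)

Topic `Literature/MathematicalPhysics/QuantumLattice`; the bridge between the Grassmann layer
(`GrassmannGaussianMoments.lean`: the Wick rule `∫ e^{ψ̄Aψ} ∏ₐ ψ̄_{iₐ}ψ_{jₐ} = ε det A · det[(A⁻¹)_{jₐ i_b}]`;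
`GrassmannTruncatedExpectation.lean`: `truncatedOf`, the Ursell function of the moments of pairwise
commuting elements) and the determinant-level tree expansion
(`FermionicTreeExpansion.lean`: `ursellOf (moment c G) W = treeSum c G v W`).

For the Gaussian Grassmann "integration" `X ↦ u ∫ dψ̄dψ e^{ψ̄Aψ} X` (normalised by `u ε det A = 1`)
and clusters `x ∈ ι` carrying the **balanced even monomials in paired normal form**
`ψ̃(P_x) = ∏_{f : c f = x} ψ̄_{i f} ψ_{j f}` (`clusterMonomial`), the truncated expectation
`𝓔ᵀ(ψ̃(P_x) : x ∈ W)` — the Ursell function of the simple expectations (`truncatedOf`) — equals the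
Battle–Brydges–Federbush / Gawedzki–Kupiainen–Lesniewski tree sum with propagator
`G f f' = ⟨ψ̄_{i f} ψ_{j f'}⟩ = (A⁻¹)_{j f', i f}` (`truncatedOf_gaussExp_clusterMonomial_eq_treeSum`):
this is (2.66) of BGM 2006 / (2.118) of Mastropietro 2008 for such monomials, the `t`-integral
being written as the sum over scripts of formal cube integrals (see `FermionicTreeExpansion.lean`,
`BattleFederbushWeights.lean` for the probability-measure reading and `BattleFederbushGram.lean`
for the Gram structure).  Everything is proved; no named fact.

## Sources

G. Benfatto, A. Giuliani, V. Mastropietro, Ann. Henri Poincaré 7 (2006), (2.1)–(2.3), (2.66)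
(`BenfattoGiulianiMastropietro2006`); V. Mastropietro, *Non-Perturbative Renormalization* (2008),
(2.24)/(2.30) (Wick rule), (2.79), (2.100)–(2.101), (2.118) (`Mastropietro2008`).
-/

noncomputable section

open Finset Matrix
open Literature.Probability.LatticeModels Literature.Probability.LatticeModels.BattleFederbush

namespace Literature.MathematicalPhysics.QuantumLattice

open GrassmannAlgebra

namespace FermionicTree

variable (R : Type*) [CommRing R] {n : Type*} [LinearOrder n]
variable {ι : Type*} [DecidableEq ι] {F : Type*} [Fintype F] [LinearOrder F]

/-- The field pair `f`: the central, square-zero element `ψ̄_{i f} ψ_{j f}`. [folklore] -/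
def pairOp (i j : F → n) (f : F) : GrassmannAlgebra R (n ⊕ₗ n) := psiBar R (i f) * psi R (j f)

omit [Fintype F] [LinearOrder F] in
/-- Field pairs are central. [folklore] -/
theorem commute_pairOp (i j : F → n) (f : F) (z : GrassmannAlgebra R (n ⊕ₗ n)) : Commute (pairOp R i j f) z :=
  commute_psiBar_mul_psi R _ _ z

/-- **The balanced even monomial of a cluster in paired normal form**:
`ψ̃(P_x) = ∏_{f : c f = x} ψ̄_{i f} ψ_{j f}` (the factors commute). [folklore] -/
def clusterMonomial (c : F → ι) (i j : F → n) (x : ι) : GrassmannAlgebra R (n ⊕ₗ n) :=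
  (fieldsOf c {x}).noncommProd (pairOp R i j) fun f _ _ _ _ => commute_pairOp R i j f _

omit [LinearOrder F] in
/-- Cluster monomials are central, in particular they pairwise commute. [folklore] -/
theorem commute_clusterMonomial (c : F → ι) (i j : F → n) (x : ι) (z : GrassmannAlgebra R (n ⊕ₗ n)) :
    Commute (clusterMonomial R c i j x) z :=
  (Finset.noncommProd_commute _ _ _ z fun f _ => (commute_pairOp R i j f z).symm).symm

omit [LinearOrder F] in
/-- The pairwise commutation of the cluster monomials (the hypothesis of `truncatedOf`). [folklore] -/
theorem pairwise_commute_clusterMonomial (c : F → ι) (i j : F → n) :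
    Pairwise fun x x' => Commute (clusterMonomial R c i j x) (clusterMonomial R c i j x') :=
  fun x _ _ => commute_clusterMonomial R c i j x _

/-- The (un-normalised) **Gaussian Grassmann integration as a linear map** `X ↦ (∫ dψ̄dψ e^{ψ̄Aψ} X) · 1`
(the form expected by `truncatedOf`). [folklore] -/
def gaussExp [Fintype n] [Algebra ℚ R] (A : Matrix n n R) : GrassmannAlgebra R (n ⊕ₗ n) →ₗ[R] GrassmannAlgebra R (n ⊕ₗ n) :=
  Algebra.linearMap R _ ∘ₗ (berezin R (n ⊕ₗ n) ∘ₗ LinearMap.mulLeft R (grassmannExp (quadratic R A)))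

/-- The scalar part of the Gaussian integration map is the Berezin integral. [folklore] -/
theorem scalarPart_gaussExp [Fintype n] [Algebra ℚ R] (A : Matrix n n R) (X : GrassmannAlgebra R (n ⊕ₗ n)) :
    scalarPart R (gaussExp R A X) = berezin R (n ⊕ₗ n) (grassmannExp (quadratic R A) * X) := by
  simp [gaussExp]

/-- The product of the cluster monomials of the clusters in `Q` is the product of all their field
pairs. [folklore] -/
theorem noncommProd_clusterMonomial (c : F → ι) (i j : F → n) (Q : Finset ι) :
    Q.noncommProd (clusterMonomial R c i j) (fun _ _ _ _ h => pairwise_commute_clusterMonomial R c i j h) =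
      (fieldsOf c Q).noncommProd (pairOp R i j) fun f _ _ _ _ => commute_pairOp R i j f _ := by
  induction Q using Finset.induction_on with
  | empty =>
    rw [Finset.noncommProd_empty]
    have : fieldsOf c (∅ : Finset ι) = ∅ := by ext f; simp [fieldsOf]
    rw [Finset.noncommProd_congr this (fun _ _ => rfl), Finset.noncommProd_empty]
  | insert x Q hx ih =>
    rw [Finset.noncommProd_insert_of_notMem _ _ _ _ hx, ih, clusterMonomial]
    have hdisj : Disjoint (fieldsOf c {x}) (fieldsOf c Q) := by
      rw [Finset.disjoint_left]
      intro f hf hf'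
      rw [mem_fieldsOf, mem_singleton] at hf
      rw [mem_fieldsOf] at hf'
      exact hx (hf ▸ hf')
    have hunion : fieldsOf c (insert x Q) = fieldsOf c {x} ∪ fieldsOf c Q := by
      ext f; simp [fieldsOf]
    rw [Finset.noncommProd_congr hunion (fun _ _ => rfl), Finset.noncommProd_union_of_disjoint hdisj]

/-- The product of the field pairs of `Q`, increasingly enumerated, as a list product. [folklore] -/
theorem noncommProd_fieldsOf_eq_prod_ofFn (c : F → ι) (i j : F → n) (Q : Finset ι) :
    (fieldsOf c Q).noncommProd (pairOp R i j) (fun f _ _ _ _ => commute_pairOp R i j f _) =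
      (List.ofFn fun a => psiBar R (i (enum c Q a)) * psi R (j (enum c Q a))).prod := by
  have hlist : (List.ofFn fun a => psiBar R (i (enum c Q a)) * psi R (j (enum c Q a))) =
      ((fieldsOf c Q).sort (· ≤ ·)).map (pairOp R i j) := by
    apply List.ext_getElem
    · simp
    · intro m h₁ h₂
      simp only [List.getElem_ofFn, List.getElem_map, enum, Finset.orderEmbOfFin_apply, pairOp, Fin.getElem_fin]
  rw [hlist, ← Finset.noncommProd_toFinset _ (pairOp R i j) _ (Finset.sort_nodup _ _)]
  exact Finset.noncommProd_congr (Finset.sort_toFinset _ _).symm (fun _ _ => rfl) _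

variable [Fintype n] [Algebra ℚ R]

/-- **The moments of the cluster monomials are the determinants `moment c G`** with
`G f f' = (A⁻¹)_{j f, i f'}` (Wick rule), for the normalised Gaussian integration `u ∫ e^{ψ̄Aψ}`,
`u ε det A = 1`, `ε = (-1)^{|n|(|n|-1)/2}` (Mastropietro 2008, (2.24)/(2.79)). [cite: Mastropietro2008, Ch. 2 (2.24)] -/
theorem scalarPart_gaussExp_noncommProd (A : Matrix n n R) (hA : IsUnit A.det) (u : R)
    (hu : u * ((-1 : R) ^ (Fintype.card n * (Fintype.card n - 1) / 2) * A.det) = 1)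
    (c : F → ι) (i j : F → n) (Q : Finset ι) :
    u * scalarPart R (gaussExp R A (Q.noncommProd (clusterMonomial R c i j)
      fun _ _ _ _ h => pairwise_commute_clusterMonomial R c i j h)) =
      moment c (Matrix.of fun f f' => A⁻¹ (j f) (i f')) Q := by
  rw [scalarPart_gaussExp, noncommProd_clusterMonomial, noncommProd_fieldsOf_eq_prod_ofFn,
    berezin_grassmannExp_quadratic_mul_prod R A hA, ← mul_assoc, hu, one_mul, moment]
  rfl

/-- **The tree expansion of the truncated expectations of a Gaussian Grassmann integration**
(Benfatto–Giuliani–Mastropietro 2006, (2.66); Mastropietro 2008, (2.101)/(2.118); for balanced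
even monomials in paired normal form): for the normalised Gaussian Grassmann integration
`𝓔 = u ∫ dψ̄dψ e^{ψ̄Aψ} (·)` (`u ε det A = 1`) and the cluster monomials
`ψ̃(P_x) = ∏_{f : c f = x} ψ̄_{i f} ψ_{j f}`, the truncated expectation of the clusters in `W` equals the
tree sum with propagator `G f f' = ⟨ψ̄_{i f} ψ_{j f'}⟩ = (A⁻¹)_{j f', i f}` … here indexed as
`G f f' = (A⁻¹)_{j f, i f'}` (row = `ψ̄`-carrying pair, column = `ψ`-carrying pair):
`𝓔ᵀ(ψ̃(P_x) : x ∈ W) = Σ_{scripts/anchored trees} ∏ G_ℓ ∫ w_s det G^T(σ_s)`, for every root `v ∈ W`. [cite: BenfattoGiulianiMastropietro2006, (2.66)] -/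
theorem truncatedOf_gaussExp_clusterMonomial_eq_treeSum [Fintype ι] (A : Matrix n n R) (hA : IsUnit A.det)
    (u : R) (hu : u * ((-1 : R) ^ (Fintype.card n * (Fintype.card n - 1) / 2) * A.det) = 1)
    (c : F → ι) (i j : F → n) (W : Finset ι) {v : ι} (hv : v ∈ W) :
    truncatedOf R (u • gaussExp R A) (clusterMonomial R c i j) (pairwise_commute_clusterMonomial R c i j) W =
      treeSum c (Matrix.of fun f f' => A⁻¹ (j f) (i f')) v W := by
  rw [← ursellOf_moment_eq_treeSum c _ W hv, truncatedOf]
  congr 1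
  funext Q
  rw [LinearMap.smul_apply, map_smul, smul_eq_mul, scalarPart_gaussExp_noncommProd R A hA u hu]

end FermionicTree

end Literature.MathematicalPhysics.QuantumLattice
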